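import Literature.AnabelianGeometry.SemiGraphs.PSCTwoComponentAffinePointedOrigin
import Literature.AnabelianGeometry.SemiGraphs.PSCTwoComponentUnmarkedOrigin
import Literature.AnabelianGeometry.SemiGraphs.PSCIrreducibleMultiNodalOrigin
import HarnessLib

/-!
# One origin for all the nodal shapes: [CombGC] Prop. 1.2 (i), [IUTchI] Rmk. 1.2.3 (iv) (cuspidal), [CombGC] Thm. 1.6 (i)

Mochizuki, *A combinatorial version of the Grothendieck conjecture* [CombGC] §1: Prop. 1.2 (i) p. 8, Thm.
1.6 (i) p. 13; *Inter-universal Teichmüller theory I* [IUTchI] Rmk. 1.2.3 (iv) pp. 41–42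
[cite: MochizukiCombGC2007, Thm 1.6(i) p.13] [cite: MochizukiCombGC2007, Prop 1.2(i) p.8]
[cite: Mochizuki2012, IUTchI Rmk 1.2.3(iv) pp.41-42].  PROOF-ONLY capstone (abc-iut-f-164 gen 2; rows F-0459
`PSCDatum.OpenInterDeterminesComponentHolds`, F-1931 `PSCDatum.CuspidalEdgeLikeCharacterizationHolds`, F-0458
`PSCDatum.NumericallyCuspidalIffHolds`).

The rows are ORIGIN-level statements: Thm. 1.6 (i) quantifies over PAIRS of data `G`, `H` of `Ω`-type and
isomorphisms `α : Π_G ≅ Π_H`, so an origin containing data of DIFFERENT shapes says more than the separate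
shape origins of the earlier files.  Here `Ω` declares "of PSC-type" (with `Σ = {l}`) every datum of ANY
of the shapes treated by this lineage — over a profinite pro-`Σ'` completion `ι : Γ_{g,r} → Π` with the cusp
groups the closed cusp inertia groups:

* (A) two components pointed on both sides (`PSCTwoComponentAffinePointedOrigin.lean`);
* (B) two components, one unmarked (`PSCTwoComponentUnmarkedOrigin.lean`);
* (C) irreducible with `k ≤ g` self-nodes (`PSCIrreducibleMultiNodalOrigin.lean`) — `k = 0` is the SMOOTH
  affine curve of type `(g, r)`, `k = 1` the one-nodal irreducible curves incl. the one-pointed nodal cubic.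

So `Ω` contains (the data of the shape of) every smooth hyperbolic affine curve, every one-nodal pointed
stable curve with a marked point, and every irreducible nodal curve; and
`exists_nodalShapesOrigin_thm16i_holds` proves F-0459 ∧ F-1931 ∧ F-0458 AT THIS SINGLE ORIGIN — in
particular "`α` numerically cuspidal ⟺ group-theoretically cuspidal" for `α : Π_G ≅ Π_H` between data of
any two of these shapes.  The proof is datum-wise (abc-iut-w4-d052's reduction behind
`numericallyCuspidalIffHolds_of_characterization` needs Prop. 1.2 (i) edge-like and Rmk. 1.2.3 (iv) for `G`
and for `H` separately).  Inhabited e.g. by the two-tripods datum.  Instance forms at data of genuine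
shapes; consistency evidence for the typed rows, not the printed theorems for all pointed stable curves.
Nothing here takes a side on [IUTchIII] Cor. 3.12.
-/

noncomputable section

namespace Literature.AnabelianGeometry.SemiGraphs

open scoped Pointwise
open Literature.GroupTheory.CombinatorialGroupTheory
open SemiGraphOfAnabelioids (IsProSigmaCompletion)

universe u

namespace PSCDatum

section Origin

variable (Ω : PSCOrigin.{u}) (l : ℕ)

/-- **F-0459 at every origin all of whose data have one of the shapes (A), (B), (C).**
[cite: MochizukiCombGC2007, Prop 1.2(i) p.8] -/
theorem openInterDeterminesComponentHolds_of_nodalShapes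
    (hΩ : ∀ ⦃Q : Type u⦄ [Group Q] [TopologicalSpace Q] [IsTopologicalGroup Q] (G : PSCDatum Q),
      Ω.IsOfPSCType G → CompactSpace Q ∧ T2Space Q ∧ TotallyDisconnectedSpace Q ∧
        ((∃ (S : Set ℕ) (g r g₀ s : ℕ) (ι : PuncturedSurfaceGroup g r →* Q) (e : G.graph.C ≃ Fin r)
            (v₀ v₁ : G.graph.V) (n₀ : G.graph.N) (ε : PuncturedSurfaceGroup g r),
            S.Nonempty ∧ (∀ p ∈ S, p.Prime) ∧ IsProSigmaCompletion S ι ∧ (g₀ ≤ g ∧ 1 ≤ s ∧ s + 1 ≤ r ∧ (1 ≤ g₀ ∨ 2 ≤ r - s) ∧ (1 ≤ g - g₀ ∨ 2 ≤ s)) ∧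
            (∀ c, G.cuspGp c =
              ((PuncturedSurfaceGroup.cuspInertia (g := g) (e c)).map ι).topologicalClosure) ∧
            (∀ w, w = v₀ ∨ w = v₁) ∧ (∀ n, n = n₀) ∧
            ε = ((List.finRange r).map fun j : Fin r =>
              if s ≤ (j : ℕ) then PuncturedSurfaceGroup.c (g := g) j else 1).prod *
            ((List.finRange g).map fun i : Fin g => if (i : ℕ) < g₀ then
              PuncturedSurfaceGroup.a (r := r) i * PuncturedSurfaceGroup.b i *
                (PuncturedSurfaceGroup.a i)⁻¹ * (PuncturedSurfaceGroup.b i)⁻¹ else 1).prod ∧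
            G.vertGp v₀ = ((Subgroup.closure {x : PuncturedSurfaceGroup g r |
              (∃ i : Fin g, (i : ℕ) < g₀ ∧ (x = PuncturedSurfaceGroup.a i ∨ x = PuncturedSurfaceGroup.b i)) ∨
              ∃ j : Fin r, s ≤ (j : ℕ) ∧ x = PuncturedSurfaceGroup.c j}).map ι).topologicalClosure ∧
            G.vertGp v₁ = ((Subgroup.closure {x : PuncturedSurfaceGroup g r |
              (∃ i : Fin g, g₀ ≤ (i : ℕ) ∧ (x = PuncturedSurfaceGroup.a i ∨ x = PuncturedSurfaceGroup.b i)) ∨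
              (∃ j : Fin r, (j : ℕ) < s ∧ x = PuncturedSurfaceGroup.c j) ∨ x = ε}).map ι).topologicalClosure ∧
            G.nodeGp n₀ = ((Subgroup.zpowers ε).map ι).topologicalClosure ∧
            G.genus v₀ = g₀ ∧ G.genus v₁ = g - g₀) ∨
          (∃ (S : Set ℕ) (g r g₀ s : ℕ) (ι : PuncturedSurfaceGroup g r →* Q) (e : G.graph.C ≃ Fin r)
            (v₀ v₁ : G.graph.V) (n₀ : G.graph.N) (ε : PuncturedSurfaceGroup g r),
            S.Nonempty ∧ (∀ p ∈ S, p.Prime) ∧ IsProSigmaCompletion S ι ∧ (g₀ ≤ g ∧ s = 0 ∧ 1 ≤ r ∧ (1 ≤ g₀ ∨ 2 ≤ r) ∧ 1 ≤ g - g₀) ∧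
            (∀ c, G.cuspGp c =
              ((PuncturedSurfaceGroup.cuspInertia (g := g) (e c)).map ι).topologicalClosure) ∧
            (∀ w, w = v₀ ∨ w = v₁) ∧ (∀ n, n = n₀) ∧
            ε = ((List.finRange r).map fun j : Fin r =>
              if s ≤ (j : ℕ) then PuncturedSurfaceGroup.c (g := g) j else 1).prod *
            ((List.finRange g).map fun i : Fin g => if (i : ℕ) < g₀ then
              PuncturedSurfaceGroup.a (r := r) i * PuncturedSurfaceGroup.b i *
                (PuncturedSurfaceGroup.a i)⁻¹ * (PuncturedSurfaceGroup.b i)⁻¹ else 1).prod ∧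
            G.vertGp v₀ = ((Subgroup.closure {x : PuncturedSurfaceGroup g r |
              (∃ i : Fin g, (i : ℕ) < g₀ ∧ (x = PuncturedSurfaceGroup.a i ∨ x = PuncturedSurfaceGroup.b i)) ∨
              ∃ j : Fin r, s ≤ (j : ℕ) ∧ x = PuncturedSurfaceGroup.c j}).map ι).topologicalClosure ∧
            G.vertGp v₁ = ((Subgroup.closure {x : PuncturedSurfaceGroup g r |
              (∃ i : Fin g, g₀ ≤ (i : ℕ) ∧ (x = PuncturedSurfaceGroup.a i ∨ x = PuncturedSurfaceGroup.b i)) ∨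
              (∃ j : Fin r, (j : ℕ) < s ∧ x = PuncturedSurfaceGroup.c j) ∨ x = ε}).map ι).topologicalClosure ∧
            G.nodeGp n₀ = ((Subgroup.zpowers ε).map ι).topologicalClosure ∧
            G.genus v₀ = g₀ ∧ G.genus v₁ = g - g₀) ∨
          (∃ (S : Set ℕ) (g r k : ℕ) (hk : k ≤ g) (ι : PuncturedSurfaceGroup g r →* Q)
            (e : G.graph.C ≃ Fin r) (v₀ : G.graph.V) (eN : G.graph.N ≃ Fin k),
            S.Nonempty ∧ (∀ p ∈ S, p.Prime) ∧ IsProSigmaCompletion S ι ∧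
            PuncturedSurfaceGroup.IsHyperbolicType g r ∧
            (∀ c, G.cuspGp c =
              ((PuncturedSurfaceGroup.cuspInertia (g := g) (e c)).map ι).topologicalClosure) ∧
            (∀ w, w = v₀) ∧
            (∀ m, G.nodeGp m = ((Subgroup.zpowers
              (PuncturedSurfaceGroup.b (r := r) (Fin.castLE hk (eN m)))).map ι).topologicalClosure)))) :
    OpenInterDeterminesComponentHolds Ω := by
  intro Q _ _ _ G hG
  obtain ⟨hc, ht, hd, hA | hB | hC'⟩ := hΩ G hG
  · obtain ⟨S, g, r, g₀, s, ι, e, v₀, v₁, n₀, ε, hne, hprime, hι, ⟨hg₀, hs, hsr, hst₀, hst₁⟩, hC, hV, hN,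
      hε, hV₀, hV₁, hE, hgen₀, hgen₁⟩ := hA
    exact G.openInterDeterminesComponent_of_twoComponentAffine' hne hprime ι hι hg₀ hs hsr hst₀ hst₁ e hC
      v₀ v₁ hV ε hε hV₀ hV₁ n₀ hN hE hgen₀ hgen₁
  · obtain ⟨S, g, r, g₀, s, ι, e, v₀, v₁, n₀, ε, hne, hprime, hι, ⟨hg₀, hs, hr, hst₀, hg₁⟩, hC, hV, hN,
      hε, hV₀, hV₁, hE, hgen₀, hgen₁⟩ := hB
    exact G.openInterDeterminesComponent_of_twoComponentUnmarked hne hprime ι hι hg₀ hs hr hst₀ hg₁ e hC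
      v₀ v₁ hV ε hε hV₀ hV₁ n₀ hN hE hgen₀ hgen₁
  · obtain ⟨S, g, r, k, hk, ι, e, v₀, eN, hne, hprime, hι, hhyp, hC, hV, hE⟩ := hC'
    exact G.openInterDeterminesComponent_of_irreducibleMultiNodal hne hprime ι hι hk hhyp e hC v₀ hV eN hE

/-- **F-1931 at every origin all of whose data have one of the shapes (A), (B), (C)** (all are cuspidally
standard). [cite: Mochizuki2012, IUTchI Rmk 1.2.3(iv) pp.41-42] -/
theorem cuspidalEdgeLikeCharacterizationHolds_of_nodalShapes
    (hΩ : ∀ ⦃Q : Type u⦄ [Group Q] [TopologicalSpace Q] [IsTopologicalGroup Q] (G : PSCDatum Q),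
      Ω.IsOfPSCType G → CompactSpace Q ∧ T2Space Q ∧ TotallyDisconnectedSpace Q ∧
        ((∃ (S : Set ℕ) (g r g₀ s : ℕ) (ι : PuncturedSurfaceGroup g r →* Q) (e : G.graph.C ≃ Fin r)
            (v₀ v₁ : G.graph.V) (n₀ : G.graph.N) (ε : PuncturedSurfaceGroup g r),
            S.Nonempty ∧ (∀ p ∈ S, p.Prime) ∧ IsProSigmaCompletion S ι ∧ (g₀ ≤ g ∧ 1 ≤ s ∧ s + 1 ≤ r ∧ (1 ≤ g₀ ∨ 2 ≤ r - s) ∧ (1 ≤ g - g₀ ∨ 2 ≤ s)) ∧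
            (∀ c, G.cuspGp c =
              ((PuncturedSurfaceGroup.cuspInertia (g := g) (e c)).map ι).topologicalClosure) ∧
            (∀ w, w = v₀ ∨ w = v₁) ∧ (∀ n, n = n₀) ∧
            ε = ((List.finRange r).map fun j : Fin r =>
              if s ≤ (j : ℕ) then PuncturedSurfaceGroup.c (g := g) j else 1).prod *
            ((List.finRange g).map fun i : Fin g => if (i : ℕ) < g₀ then
              PuncturedSurfaceGroup.a (r := r) i * PuncturedSurfaceGroup.b i *
                (PuncturedSurfaceGroup.a i)⁻¹ * (PuncturedSurfaceGroup.b i)⁻¹ else 1).prod ∧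
            G.vertGp v₀ = ((Subgroup.closure {x : PuncturedSurfaceGroup g r |
              (∃ i : Fin g, (i : ℕ) < g₀ ∧ (x = PuncturedSurfaceGroup.a i ∨ x = PuncturedSurfaceGroup.b i)) ∨
              ∃ j : Fin r, s ≤ (j : ℕ) ∧ x = PuncturedSurfaceGroup.c j}).map ι).topologicalClosure ∧
            G.vertGp v₁ = ((Subgroup.closure {x : PuncturedSurfaceGroup g r |
              (∃ i : Fin g, g₀ ≤ (i : ℕ) ∧ (x = PuncturedSurfaceGroup.a i ∨ x = PuncturedSurfaceGroup.b i)) ∨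
              (∃ j : Fin r, (j : ℕ) < s ∧ x = PuncturedSurfaceGroup.c j) ∨ x = ε}).map ι).topologicalClosure ∧
            G.nodeGp n₀ = ((Subgroup.zpowers ε).map ι).topologicalClosure ∧
            G.genus v₀ = g₀ ∧ G.genus v₁ = g - g₀) ∨
          (∃ (S : Set ℕ) (g r g₀ s : ℕ) (ι : PuncturedSurfaceGroup g r →* Q) (e : G.graph.C ≃ Fin r)
            (v₀ v₁ : G.graph.V) (n₀ : G.graph.N) (ε : PuncturedSurfaceGroup g r),
            S.Nonempty ∧ (∀ p ∈ S, p.Prime) ∧ IsProSigmaCompletion S ι ∧ (g₀ ≤ g ∧ s = 0 ∧ 1 ≤ r ∧ (1 ≤ g₀ ∨ 2 ≤ r) ∧ 1 ≤ g - g₀) ∧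
            (∀ c, G.cuspGp c =
              ((PuncturedSurfaceGroup.cuspInertia (g := g) (e c)).map ι).topologicalClosure) ∧
            (∀ w, w = v₀ ∨ w = v₁) ∧ (∀ n, n = n₀) ∧
            ε = ((List.finRange r).map fun j : Fin r =>
              if s ≤ (j : ℕ) then PuncturedSurfaceGroup.c (g := g) j else 1).prod *
            ((List.finRange g).map fun i : Fin g => if (i : ℕ) < g₀ then
              PuncturedSurfaceGroup.a (r := r) i * PuncturedSurfaceGroup.b i *
                (PuncturedSurfaceGroup.a i)⁻¹ * (PuncturedSurfaceGroup.b i)⁻¹ else 1).prod ∧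
            G.vertGp v₀ = ((Subgroup.closure {x : PuncturedSurfaceGroup g r |
              (∃ i : Fin g, (i : ℕ) < g₀ ∧ (x = PuncturedSurfaceGroup.a i ∨ x = PuncturedSurfaceGroup.b i)) ∨
              ∃ j : Fin r, s ≤ (j : ℕ) ∧ x = PuncturedSurfaceGroup.c j}).map ι).topologicalClosure ∧
            G.vertGp v₁ = ((Subgroup.closure {x : PuncturedSurfaceGroup g r |
              (∃ i : Fin g, g₀ ≤ (i : ℕ) ∧ (x = PuncturedSurfaceGroup.a i ∨ x = PuncturedSurfaceGroup.b i)) ∨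
              (∃ j : Fin r, (j : ℕ) < s ∧ x = PuncturedSurfaceGroup.c j) ∨ x = ε}).map ι).topologicalClosure ∧
            G.nodeGp n₀ = ((Subgroup.zpowers ε).map ι).topologicalClosure ∧
            G.genus v₀ = g₀ ∧ G.genus v₁ = g - g₀) ∨
          (∃ (S : Set ℕ) (g r k : ℕ) (hk : k ≤ g) (ι : PuncturedSurfaceGroup g r →* Q)
            (e : G.graph.C ≃ Fin r) (v₀ : G.graph.V) (eN : G.graph.N ≃ Fin k),
            S.Nonempty ∧ (∀ p ∈ S, p.Prime) ∧ IsProSigmaCompletion S ι ∧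
            PuncturedSurfaceGroup.IsHyperbolicType g r ∧
            (∀ c, G.cuspGp c =
              ((PuncturedSurfaceGroup.cuspInertia (g := g) (e c)).map ι).topologicalClosure) ∧
            (∀ w, w = v₀) ∧
            (∀ m, G.nodeGp m = ((Subgroup.zpowers
              (PuncturedSurfaceGroup.b (r := r) (Fin.castLE hk (eN m)))).map ι).topologicalClosure)))) :
    CuspidalEdgeLikeCharacterizationHolds Ω := by
  refine cuspidalEdgeLikeCharacterizationHolds_of_cuspidallyStandard Ω fun Q _ _ _ G hG => ?_
  obtain ⟨hc, ht, hd, hA | hB | hC'⟩ := hΩ G hG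
  · obtain ⟨S, g, r, g₀, s, ι, e, v₀, v₁, n₀, ε, hne, hprime, hι, ⟨hg₀, hs, hsr, hst₀, hst₁⟩, hC, -⟩ := hA
    exact ⟨hc, ht, hd, S, g, r, ι, e, hne, hprime,
      by unfold PuncturedSurfaceGroup.IsHyperbolicType; omega, hι, hC⟩
  · obtain ⟨S, g, r, g₀, s, ι, e, v₀, v₁, n₀, ε, hne, hprime, hι, ⟨hg₀, hs, hr, hst₀, hg₁⟩, hC, -⟩ := hB
    exact ⟨hc, ht, hd, S, g, r, ι, e, hne, hprime,
      by unfold PuncturedSurfaceGroup.IsHyperbolicType; omega, hι, hC⟩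
  · obtain ⟨S, g, r, k, hk, ι, e, v₀, eN, hne, hprime, hι, hhyp, hC, -⟩ := hC'
    exact ⟨hc, ht, hd, S, g, r, ι, e, hne, hprime, hhyp, hι, hC⟩

/-- **F-0458 at every origin all of whose data have one of the shapes (A), (B), (C), `Σ = {l}`**:
"`α` is numerically cuspidal iff group-theoretically cuspidal" for `α : Π_G ≅ Π_H` between data of ANY two
of these shapes. [cite: MochizukiCombGC2007, Thm 1.6(i) p.13] -/
theorem numericallyCuspidalIffHolds_of_nodalShapes
    (hΩ : ∀ ⦃Q : Type u⦄ [Group Q] [TopologicalSpace Q] [IsTopologicalGroup Q] (G : PSCDatum Q),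
      Ω.IsOfPSCType G → CompactSpace Q ∧ T2Space Q ∧ TotallyDisconnectedSpace Q ∧
        ((∃ (S : Set ℕ) (g r g₀ s : ℕ) (ι : PuncturedSurfaceGroup g r →* Q) (e : G.graph.C ≃ Fin r)
            (v₀ v₁ : G.graph.V) (n₀ : G.graph.N) (ε : PuncturedSurfaceGroup g r),
            S.Nonempty ∧ (∀ p ∈ S, p.Prime) ∧ IsProSigmaCompletion S ι ∧ (g₀ ≤ g ∧ 1 ≤ s ∧ s + 1 ≤ r ∧ (1 ≤ g₀ ∨ 2 ≤ r - s) ∧ (1 ≤ g - g₀ ∨ 2 ≤ s)) ∧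
            (∀ c, G.cuspGp c =
              ((PuncturedSurfaceGroup.cuspInertia (g := g) (e c)).map ι).topologicalClosure) ∧
            (∀ w, w = v₀ ∨ w = v₁) ∧ (∀ n, n = n₀) ∧
            ε = ((List.finRange r).map fun j : Fin r =>
              if s ≤ (j : ℕ) then PuncturedSurfaceGroup.c (g := g) j else 1).prod *
            ((List.finRange g).map fun i : Fin g => if (i : ℕ) < g₀ then
              PuncturedSurfaceGroup.a (r := r) i * PuncturedSurfaceGroup.b i *
                (PuncturedSurfaceGroup.a i)⁻¹ * (PuncturedSurfaceGroup.b i)⁻¹ else 1).prod ∧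
            G.vertGp v₀ = ((Subgroup.closure {x : PuncturedSurfaceGroup g r |
              (∃ i : Fin g, (i : ℕ) < g₀ ∧ (x = PuncturedSurfaceGroup.a i ∨ x = PuncturedSurfaceGroup.b i)) ∨
              ∃ j : Fin r, s ≤ (j : ℕ) ∧ x = PuncturedSurfaceGroup.c j}).map ι).topologicalClosure ∧
            G.vertGp v₁ = ((Subgroup.closure {x : PuncturedSurfaceGroup g r |
              (∃ i : Fin g, g₀ ≤ (i : ℕ) ∧ (x = PuncturedSurfaceGroup.a i ∨ x = PuncturedSurfaceGroup.b i)) ∨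
              (∃ j : Fin r, (j : ℕ) < s ∧ x = PuncturedSurfaceGroup.c j) ∨ x = ε}).map ι).topologicalClosure ∧
            G.nodeGp n₀ = ((Subgroup.zpowers ε).map ι).topologicalClosure ∧
            G.genus v₀ = g₀ ∧ G.genus v₁ = g - g₀) ∨
          (∃ (S : Set ℕ) (g r g₀ s : ℕ) (ι : PuncturedSurfaceGroup g r →* Q) (e : G.graph.C ≃ Fin r)
            (v₀ v₁ : G.graph.V) (n₀ : G.graph.N) (ε : PuncturedSurfaceGroup g r),
            S.Nonempty ∧ (∀ p ∈ S, p.Prime) ∧ IsProSigmaCompletion S ι ∧ (g₀ ≤ g ∧ s = 0 ∧ 1 ≤ r ∧ (1 ≤ g₀ ∨ 2 ≤ r) ∧ 1 ≤ g - g₀) ∧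
            (∀ c, G.cuspGp c =
              ((PuncturedSurfaceGroup.cuspInertia (g := g) (e c)).map ι).topologicalClosure) ∧
            (∀ w, w = v₀ ∨ w = v₁) ∧ (∀ n, n = n₀) ∧
            ε = ((List.finRange r).map fun j : Fin r =>
              if s ≤ (j : ℕ) then PuncturedSurfaceGroup.c (g := g) j else 1).prod *
            ((List.finRange g).map fun i : Fin g => if (i : ℕ) < g₀ then
              PuncturedSurfaceGroup.a (r := r) i * PuncturedSurfaceGroup.b i *
                (PuncturedSurfaceGroup.a i)⁻¹ * (PuncturedSurfaceGroup.b i)⁻¹ else 1).prod ∧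
            G.vertGp v₀ = ((Subgroup.closure {x : PuncturedSurfaceGroup g r |
              (∃ i : Fin g, (i : ℕ) < g₀ ∧ (x = PuncturedSurfaceGroup.a i ∨ x = PuncturedSurfaceGroup.b i)) ∨
              ∃ j : Fin r, s ≤ (j : ℕ) ∧ x = PuncturedSurfaceGroup.c j}).map ι).topologicalClosure ∧
            G.vertGp v₁ = ((Subgroup.closure {x : PuncturedSurfaceGroup g r |
              (∃ i : Fin g, g₀ ≤ (i : ℕ) ∧ (x = PuncturedSurfaceGroup.a i ∨ x = PuncturedSurfaceGroup.b i)) ∨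
              (∃ j : Fin r, (j : ℕ) < s ∧ x = PuncturedSurfaceGroup.c j) ∨ x = ε}).map ι).topologicalClosure ∧
            G.nodeGp n₀ = ((Subgroup.zpowers ε).map ι).topologicalClosure ∧
            G.genus v₀ = g₀ ∧ G.genus v₁ = g - g₀) ∨
          (∃ (S : Set ℕ) (g r k : ℕ) (hk : k ≤ g) (ι : PuncturedSurfaceGroup g r →* Q)
            (e : G.graph.C ≃ Fin r) (v₀ : G.graph.V) (eN : G.graph.N ≃ Fin k),
            S.Nonempty ∧ (∀ p ∈ S, p.Prime) ∧ IsProSigmaCompletion S ι ∧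
            PuncturedSurfaceGroup.IsHyperbolicType g r ∧
            (∀ c, G.cuspGp c =
              ((PuncturedSurfaceGroup.cuspInertia (g := g) (e c)).map ι).topologicalClosure) ∧
            (∀ w, w = v₀) ∧
            (∀ m, G.nodeGp m = ((Subgroup.zpowers
              (PuncturedSurfaceGroup.b (r := r) (Fin.castLE hk (eN m)))).map ι).topologicalClosure))))
    (hSig : ∀ ⦃Q : Type u⦄ [Group Q] [TopologicalSpace Q] [IsTopologicalGroup Q] (G : PSCDatum Q),
      Ω.IsOfPSCType G → G.Sigma = {l}) :
    NumericallyCuspidalIffHolds Ω :=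
  numericallyCuspidalIffHolds_of_characterization Ω l
    (fun _ _ _ _ G hG => ⟨(hΩ G hG).1, (hΩ G hG).2.2.1⟩) hSig
    (openInterDeterminesComponentHolds_of_nodalShapes Ω hΩ)
    (cuspidalEdgeLikeCharacterizationHolds_of_nodalShapes Ω hΩ)

end Origin

/-! ### The single origin with `Σ = {l}` -/

/-- **One origin for all the shapes of this lineage.**  For a prime `l`, let `Ω` declare "of PSC-type"
every datum with `Σ = {l}` of shape (A) two components pointed on both sides, (B) two components with one
unmarked, or (C) irreducible with `k ≤ g` self-nodes (`k = 0`: smooth affine curves), over profinite pro-`Σ'`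
completions of punctured surface groups.  Then F-0459 ([CombGC] Prop. 1.2 (i)), F-1931 ([IUTchI] Rmk.
1.2.3 (iv), cuspidal) and F-0458 ([CombGC] Thm. 1.6 (i)) HOLD at `Ω` — across shapes —, and `Ω` is
inhabited (here: by the two-tripods datum over `Γ_{0,4}`; by the earlier files also by every other listed
shape).  Consistency evidence for the typed rows, not the printed theorems for all pointed stable curves.
[cite: MochizukiCombGC2007, Thm 1.6(i) p.13] [cite: MochizukiCombGC2007, Prop 1.2(i) p.8]
[cite: Mochizuki2012, IUTchI Rmk 1.2.3(iv) pp.41-42] -/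
theorem exists_nodalShapesOrigin_thm16i_holds (l : ℕ) (hl : l.Prime) :
    ∃ Ω : PSCOrigin.{0},
      (∃ (Q : ProfiniteGrp.{0}) (G : PSCDatum Q), Ω.IsOfPSCType G ∧ G.graph.i = 2 ∧ G.graph.n = 1 ∧
        G.graph.r = 4) ∧
      OpenInterDeterminesComponentHolds Ω ∧ CuspidalEdgeLikeCharacterizationHolds Ω ∧
      NumericallyCuspidalIffHolds Ω := by
  classical
  let Ω : PSCOrigin.{0} :=
    ⟨fun {Q} _ _ G => ∃ (_ : IsTopologicalGroup Q), G.Sigma = {l} ∧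
      (CompactSpace Q ∧ T2Space Q ∧ TotallyDisconnectedSpace Q ∧
        ((∃ (S : Set ℕ) (g r g₀ s : ℕ) (ι : PuncturedSurfaceGroup g r →* Q) (e : G.graph.C ≃ Fin r)
            (v₀ v₁ : G.graph.V) (n₀ : G.graph.N) (ε : PuncturedSurfaceGroup g r),
            S.Nonempty ∧ (∀ p ∈ S, p.Prime) ∧ IsProSigmaCompletion S ι ∧ (g₀ ≤ g ∧ 1 ≤ s ∧ s + 1 ≤ r ∧ (1 ≤ g₀ ∨ 2 ≤ r - s) ∧ (1 ≤ g - g₀ ∨ 2 ≤ s)) ∧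
            (∀ c, G.cuspGp c =
              ((PuncturedSurfaceGroup.cuspInertia (g := g) (e c)).map ι).topologicalClosure) ∧
            (∀ w, w = v₀ ∨ w = v₁) ∧ (∀ n, n = n₀) ∧
            ε = ((List.finRange r).map fun j : Fin r =>
              if s ≤ (j : ℕ) then PuncturedSurfaceGroup.c (g := g) j else 1).prod *
            ((List.finRange g).map fun i : Fin g => if (i : ℕ) < g₀ then
              PuncturedSurfaceGroup.a (r := r) i * PuncturedSurfaceGroup.b i *
                (PuncturedSurfaceGroup.a i)⁻¹ * (PuncturedSurfaceGroup.b i)⁻¹ else 1).prod ∧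
            G.vertGp v₀ = ((Subgroup.closure {x : PuncturedSurfaceGroup g r |
              (∃ i : Fin g, (i : ℕ) < g₀ ∧ (x = PuncturedSurfaceGroup.a i ∨ x = PuncturedSurfaceGroup.b i)) ∨
              ∃ j : Fin r, s ≤ (j : ℕ) ∧ x = PuncturedSurfaceGroup.c j}).map ι).topologicalClosure ∧
            G.vertGp v₁ = ((Subgroup.closure {x : PuncturedSurfaceGroup g r |
              (∃ i : Fin g, g₀ ≤ (i : ℕ) ∧ (x = PuncturedSurfaceGroup.a i ∨ x = PuncturedSurfaceGroup.b i)) ∨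
              (∃ j : Fin r, (j : ℕ) < s ∧ x = PuncturedSurfaceGroup.c j) ∨ x = ε}).map ι).topologicalClosure ∧
            G.nodeGp n₀ = ((Subgroup.zpowers ε).map ι).topologicalClosure ∧
            G.genus v₀ = g₀ ∧ G.genus v₁ = g - g₀) ∨
          (∃ (S : Set ℕ) (g r g₀ s : ℕ) (ι : PuncturedSurfaceGroup g r →* Q) (e : G.graph.C ≃ Fin r)
            (v₀ v₁ : G.graph.V) (n₀ : G.graph.N) (ε : PuncturedSurfaceGroup g r),
            S.Nonempty ∧ (∀ p ∈ S, p.Prime) ∧ IsProSigmaCompletion S ι ∧ (g₀ ≤ g ∧ s = 0 ∧ 1 ≤ r ∧ (1 ≤ g₀ ∨ 2 ≤ r) ∧ 1 ≤ g - g₀) ∧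
            (∀ c, G.cuspGp c =
              ((PuncturedSurfaceGroup.cuspInertia (g := g) (e c)).map ι).topologicalClosure) ∧
            (∀ w, w = v₀ ∨ w = v₁) ∧ (∀ n, n = n₀) ∧
            ε = ((List.finRange r).map fun j : Fin r =>
              if s ≤ (j : ℕ) then PuncturedSurfaceGroup.c (g := g) j else 1).prod *
            ((List.finRange g).map fun i : Fin g => if (i : ℕ) < g₀ then
              PuncturedSurfaceGroup.a (r := r) i * PuncturedSurfaceGroup.b i *
                (PuncturedSurfaceGroup.a i)⁻¹ * (PuncturedSurfaceGroup.b i)⁻¹ else 1).prod ∧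
            G.vertGp v₀ = ((Subgroup.closure {x : PuncturedSurfaceGroup g r |
              (∃ i : Fin g, (i : ℕ) < g₀ ∧ (x = PuncturedSurfaceGroup.a i ∨ x = PuncturedSurfaceGroup.b i)) ∨
              ∃ j : Fin r, s ≤ (j : ℕ) ∧ x = PuncturedSurfaceGroup.c j}).map ι).topologicalClosure ∧
            G.vertGp v₁ = ((Subgroup.closure {x : PuncturedSurfaceGroup g r |
              (∃ i : Fin g, g₀ ≤ (i : ℕ) ∧ (x = PuncturedSurfaceGroup.a i ∨ x = PuncturedSurfaceGroup.b i)) ∨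
              (∃ j : Fin r, (j : ℕ) < s ∧ x = PuncturedSurfaceGroup.c j) ∨ x = ε}).map ι).topologicalClosure ∧
            G.nodeGp n₀ = ((Subgroup.zpowers ε).map ι).topologicalClosure ∧
            G.genus v₀ = g₀ ∧ G.genus v₁ = g - g₀) ∨
          (∃ (S : Set ℕ) (g r k : ℕ) (hk : k ≤ g) (ι : PuncturedSurfaceGroup g r →* Q)
            (e : G.graph.C ≃ Fin r) (v₀ : G.graph.V) (eN : G.graph.N ≃ Fin k),
            S.Nonempty ∧ (∀ p ∈ S, p.Prime) ∧ IsProSigmaCompletion S ι ∧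
            PuncturedSurfaceGroup.IsHyperbolicType g r ∧
            (∀ c, G.cuspGp c =
              ((PuncturedSurfaceGroup.cuspInertia (g := g) (e c)).map ι).topologicalClosure) ∧
            (∀ w, w = v₀) ∧
            (∀ m, G.nodeGp m = ((Subgroup.zpowers
              (PuncturedSurfaceGroup.b (r := r) (Fin.castLE hk (eN m)))).map ι).topologicalClosure))))⟩
  have hSig : ∀ ⦃Q : Type⦄ [Group Q] [TopologicalSpace Q] [IsTopologicalGroup Q] (G : PSCDatum Q),
      Ω.IsOfPSCType G → G.Sigma = {l} := fun Q _ _ _ G hG => hG.2.1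
  have hl' : ∀ p ∈ ({l} : Set ℕ), p.Prime := fun p hp => by
    rw [Set.mem_singleton_iff.mp hp]; exact hl
  refine ⟨Ω, ?_, openInterDeterminesComponentHolds_of_nodalShapes Ω (fun _ _ _ _ G hG => hG.2.2),
    cuspidalEdgeLikeCharacterizationHolds_of_nodalShapes Ω (fun _ _ _ _ G hG => hG.2.2),
    numericallyCuspidalIffHolds_of_nodalShapes Ω l (fun _ _ _ _ G hG => hG.2.2) hSig⟩
  obtain ⟨Q, ι, G, e, v₀, v₁, n₀, ε, hι, hS, hi, hn, hr, hC, hV, hN, hε, hV₀, hV₁, hE, hgen₀, hgen₁, -, -⟩ :=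
    exists_twoComponentAffineDatum {l} ⟨l, rfl⟩ hl' 0 4 0 2
  exact ⟨Q, G, ⟨inferInstance, hS, inferInstance, inferInstance, inferInstance, Or.inl ⟨{l}, 0, 4, 0, 2, ι, e,
    v₀, v₁, n₀, ε, ⟨l, rfl⟩, hl', hι, ⟨le_rfl, by norm_num, by norm_num, Or.inr (by norm_num),
    Or.inr (by norm_num)⟩, hC, hV, hN, hε, hV₀, hV₁, hE, hgen₀, hgen₁⟩⟩, hi, hn, hr⟩

end PSCDatum

end Literature.AnabelianGeometry.SemiGraphs

end
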